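import Summits.QuantumFields.YangMills.Theorems.ColdStartUniversalityLatticeLangevinBlockLoopMixing
import Summits.QuantumFields.YangMills.Theorems.ColdStartUniversalityLatticeLangevinPlaquetteVariance
import HarnessLib

/-!
# Route `ColdStartUniversality` (fixed-cut-off package): LOCAL Gaussian concentration — variance and sub-Gaussian tails of BLOCK-averaged Wilson
# loops under `μ_(β')` at `|β'| < 1/12`, at the CLT scale `(R+T)/√#B` of the block, uniformly in the volume

Helper file (seat `ym-line-csu-p1`, g28; `--supports stmt-QuantumFields-24809`).  g27 proved variance/concentration for the TORUS average of a Wilson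
loop (`…WilsonLoopConcentration`, scale `(R+T)/√L³`).  With the sparsity-aware carré bound `Γ(W̄_B) ≤ 32(R+T)²/#B` (`…BlockLoopCarre`) the same
Bakry–Émery machinery (g26 log-Sobolev/Herbst `wilson_concentration_uniform`, g27 `wilson_variance_le_of_carre_uniform`) localises:
* ★★ `wilson_blockLoop_variance_uniform` — `Var_(μ_β')(W̄_B) ≤ 16(R+T)²/((1−12|β'|)·#B)`;
* ★★★ `wilson_blockLoop_concentration_uniform` — `μ_(β'){r ≤ |W̄_B − ⟨W̄_B⟩|} ≤ 2exp(−(1−12|β'|)·#B·r²/(32(R+T)²))`,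
for every nonempty `B ⊆ sites`, every `L` — equilibrium fluctuations of LOCAL averaged loops are Gaussian at the block's own CLT scale (the crux's unit
blocks: `#B = ε_K⁻³`).  HONEST FRAMING: FIXED cut-off and fixed `|β'| < 1/12`; equilibrium statements (no dynamics); 24809 ASIDE not restated; nothing
K-uniform; no crux, rung or summit statement is proved; the Yang–Mills mass gap is NOT proved.  THEOREMS ONLY, no definition, no sorry.
-/

set_option autoImplicit false

noncomputable section

namespace Summit.QuantumFields.YangMills.Theorems.ColdStartUniversality

open MeasureTheory ProbabilityTheory Matrix Complex Finset
open scoped ComplexConjugate BigOperators Matrix NNReal ENNReal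
open Literature.MathematicalPhysics.QuantumFieldTheory
open Literature.MathematicalPhysics.QuantumLattice (fundamentalRep fundamentalLatticeRep continuous_fundamentalRep fundamentalRep_apply)

variable {L : ℕ} [NeZero L]

/-- ★★ **Variance of a BLOCK-averaged `R × T` Wilson loop** at `|β'| < 1/12`, every nonempty set `B` of base points, every `L`:
`Var_(μ_β')((#B)⁻¹ Σ_(x∈B) W_(R×T)(x)) ≤ 16(R+T)²/((1 − 12|β'|)·#B)` — CLT scaling in the block size, uniformly in the volume. [cite: ShenZhuZhu2022, §4 Theorem 4.2, Corollary 4.4] -/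
theorem wilson_blockLoop_variance_uniform (L : ℕ) [NeZero L] (β' : ℝ) (hβ : |β'| < 1 / 12) (i j : Fin 3) (R T : ℕ) (B : Finset (Site 3 L)) (hB : B.Nonempty) :
    ∫ V, ((((B.card : ℝ))⁻¹ * ∑ x ∈ B, wilsonLoop (fundamentalRep (Fin 2)) x i j R T V) - ∫ V', (((B.card : ℝ))⁻¹ * ∑ x ∈ B, wilsonLoop (fundamentalRep (Fin 2)) x i j R T V') ∂(wilsonMeasure (d := 3) (L := L) (fundamentalRep (Fin 2)) β')) ^ 2 ∂(wilsonMeasure (d := 3) (L := L) (fundamentalRep (Fin 2)) β')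
      ≤ 16 * ((R : ℝ) + T) ^ 2 / ((1 - 12 * |β'|) * (B.card : ℝ)) := by
  classical
  haveI := secondCountableTopology_su2
  haveI := borelSpace_config L
  set μ : Measure (GaugeConfig 3 L (Matrix.specialUnitaryGroup (Fin 2) ℂ)) := (wilsonMeasure (d := 3) (L := L) (fundamentalRep (Fin 2)) β') with hμ
  haveI : IsProbabilityMeasure μ :=
    isProbabilityMeasure_wilsonMeasure (d := 3) (L := L) (fundamentalRep (Fin 2)) (continuous_fundamentalRep (Fin 2)) β'
  have hρ : 0 < 1 - 12 * |β'| := by linarith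
  have hS : (0 : ℝ) < (B.card : ℝ) := by exact_mod_cast hB.card_pos
  have hS0 : (B.card : ℝ) ≠ 0 := hS.ne'
  have hρ0 : (1 - 12 * |β'|) ≠ 0 := hρ.ne'
  set co : (GaugeConfig 3 L (Matrix.specialUnitaryGroup (Fin 2) ℂ)) → (Edge 3 L × Fin 2 × Fin 2 × Bool → ℝ) := (fun (V : GaugeConfig 3 L (Matrix.specialUnitaryGroup (Fin 2) ℂ)) (q : Edge 3 L × Fin 2 × Fin 2 × Bool) => (fun z : ℂ => if q.2.2.2 then z.im else z.re) ((fundamentalRep (Fin 2) (V q.1) : Matrix (Fin 2) (Fin 2) ℂ) q.2.1 q.2.2.1)) with hco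
  set fp : (Edge 3 L × Fin 2 × Fin 2 × Bool → ℝ) → ℝ := (fun y : (Edge 3 L × Fin 2 × Fin 2 × Bool → ℝ) => (2 * (B.card : ℝ))⁻¹ * ∑ x ∈ B, ((((((List.range R).map (fun m : ℕ => ((Pi.single i ((m : ℕ) : ZMod L) : Site 3 L), i, false)) ++ (List.range T).map (fun m : ℕ => ((Pi.single i ((R : ℕ) : ZMod L) : Site 3 L) + (Pi.single j ((m : ℕ) : ZMod L) : Site 3 L), j, false)) ++ ((List.range R).map (fun m : ℕ => ((Pi.single j ((T : ℕ) : ZMod L) : Site 3 L) + (Pi.single i ((m : ℕ) : ZMod L) : Site 3 L), i, true))).reverse ++ ((List.range T).map (fun m : ℕ => ((Pi.single j ((m : ℕ) : ZMod L) : Site 3 L), j, true))).reverse).map (fun q : Site 3 L × Fin 3 × Bool => ((x + q.1, q.2.1), q.2.2))).map (fun a : Edge 3 L × Bool => if a.2 then ((fun (ee : Edge 3 L) => Matrix.of fun (i j : Fin 2) => ((y (ee, i, j, false) : ℝ) : ℂ) + ((y (ee, i, j, true) : ℝ) : ℂ) * Complex.I) a.1)ᴴ else (fun (ee : Edge 3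 L) => Matrix.of fun (i j : Fin 2) => ((y (ee, i, j, false) : ℝ) : ℂ) + ((y (ee, i, j, true) : ℝ) : ℂ) * Complex.I) a.1)).prod)).trace.re) with hfp
  have hfpC : ContDiff ℝ 3 fp := contDiff_blockLoopAverage _ _ B
  have hval : ∀ V : (GaugeConfig 3 L (Matrix.specialUnitaryGroup (Fin 2) ℂ)), fp (co V) = (((B.card : ℝ))⁻¹ * ∑ x ∈ B, wilsonLoop (fundamentalRep (Fin 2)) x i j R T V) := fun V => blockLoopAverage_coords_eq V i j R T B hB
  have hvar : ∫ V, (fp (co V) - ∫ V', fp (co V') ∂μ) ^ 2 ∂μ ≤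
      (32 * ((2 * (B.card : ℝ))⁻¹) ^ 2 * (((((List.range R).map (fun m : ℕ => ((Pi.single i ((m : ℕ) : ZMod L) : Site 3 L), i, false)) ++ (List.range T).map (fun m : ℕ => ((Pi.single i ((R : ℕ) : ZMod L) : Site 3 L) + (Pi.single j ((m : ℕ) : ZMod L) : Site 3 L), j, false)) ++ ((List.range R).map (fun m : ℕ => ((Pi.single j ((T : ℕ) : ZMod L) : Site 3 L) + (Pi.single i ((m : ℕ) : ZMod L) : Site 3 L), i, true))).reverse ++ ((List.range T).map (fun m : ℕ => ((Pi.single j ((m : ℕ) : ZMod L) : Site 3 L), j, true))).reverse)).length : ℕ) : ℝ) ^ 2 * (B.card : ℝ)) / (2 * (1 - 12 * |β'|)) :=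
    wilson_variance_le_of_carre_uniform L β' fp hfpC _ hβ (wilson_blockLoopAverage_carre_le L β' _ _ B)
  have hI : ∫ V, ((((B.card : ℝ))⁻¹ * ∑ x ∈ B, wilsonLoop (fundamentalRep (Fin 2)) x i j R T V) - ∫ V', (((B.card : ℝ))⁻¹ * ∑ x ∈ B, wilsonLoop (fundamentalRep (Fin 2)) x i j R T V') ∂μ) ^ 2 ∂μ = ∫ V, (fp (co V) - ∫ V', fp (co V') ∂μ) ^ 2 ∂μ := by
    refine integral_congr_ae (ae_of_all _ fun V => ?_)
    beta_reduce
    rw [hval V]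
    congr 2
    exact integral_congr_ae (ae_of_all _ fun V' => by beta_reduce; rw [hval V'])
  have hconst : (32 * ((2 * (B.card : ℝ))⁻¹) ^ 2 * (((((List.range R).map (fun m : ℕ => ((Pi.single i ((m : ℕ) : ZMod L) : Site 3 L), i, false)) ++ (List.range T).map (fun m : ℕ => ((Pi.single i ((R : ℕ) : ZMod L) : Site 3 L) + (Pi.single j ((m : ℕ) : ZMod L) : Site 3 L), j, false)) ++ ((List.range R).map (fun m : ℕ => ((Pi.single j ((T : ℕ) : ZMod L) : Site 3 L) + (Pi.single i ((m : ℕ) : ZMod L) : Site 3 L), i, true))).reverse ++ ((List.range T).map (fun m : ℕ => ((Pi.single j ((m : ℕ) : ZMod L) : Site 3 L), j, true))).reverse)).length : ℕ) : ℝ) ^ 2 * (B.card : ℝ)) / (2 * (1 - 12 * |β'|)) =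
      16 * ((R : ℝ) + T) ^ 2 / ((1 - 12 * |β'|) * (B.card : ℝ)) := by
    rw [rectShape_length]
    push_cast
    field_simp
    ring
  rw [hI, ← hconst]
  exact hvar

/-- ★★★ **Gaussian concentration of a BLOCK-averaged `R × T` Wilson loop** at `|β'| < 1/12`: for `R + T > 0`, `B` nonempty, `r ≥ 0`,
`μ_(β'){V | r ≤ |W̄_B(V) − ∫ W̄_B dμ_(β')|} ≤ 2·exp(−(1 − 12|β'|)·#B·r²/(32(R+T)²))` — sub-Gaussian at scale `(R+T)/√#B`, uniformly in `L`.
[cite: ShenZhuZhu2022, §4 Theorem 4.2, Corollary 4.4] -/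
theorem wilson_blockLoop_concentration_uniform (L : ℕ) [NeZero L] (β' : ℝ) (hβ : |β'| < 1 / 12) (i j : Fin 3) (R T : ℕ)
    (hRT : 0 < R + T) (B : Finset (Site 3 L)) (hB : B.Nonempty) (r : ℝ) (hr : 0 ≤ r) :
    ((wilsonMeasure (d := 3) (L := L) (fundamentalRep (Fin 2)) β')).real {V | r ≤ |(((B.card : ℝ))⁻¹ * ∑ x ∈ B, wilsonLoop (fundamentalRep (Fin 2)) x i j R T V) - ∫ V', (((B.card : ℝ))⁻¹ * ∑ x ∈ B, wilsonLoop (fundamentalRep (Fin 2)) x i j R T V') ∂(wilsonMeasure (d := 3) (L := L) (fundamentalRep (Fin 2)) β')|} ≤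
      2 * Real.exp (-((1 - 12 * |β'|) * (B.card : ℝ) * r ^ 2 / (32 * ((R : ℝ) + T) ^ 2))) := by
  classical
  haveI := secondCountableTopology_su2
  haveI := borelSpace_config L
  set μ : Measure (GaugeConfig 3 L (Matrix.specialUnitaryGroup (Fin 2) ℂ)) := (wilsonMeasure (d := 3) (L := L) (fundamentalRep (Fin 2)) β') with hμ
  haveI : IsProbabilityMeasure μ :=
    isProbabilityMeasure_wilsonMeasure (d := 3) (L := L) (fundamentalRep (Fin 2)) (continuous_fundamentalRep (Fin 2)) β'
  have hS : (0 : ℝ) < (B.card : ℝ) := by exact_mod_cast hB.card_pos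
  have hS0 : (B.card : ℝ) ≠ 0 := hS.ne'
  have hRT' : (0 : ℝ) < (R : ℝ) + T := by exact_mod_cast hRT
  set co : (GaugeConfig 3 L (Matrix.specialUnitaryGroup (Fin 2) ℂ)) → (Edge 3 L × Fin 2 × Fin 2 × Bool → ℝ) := (fun (V : GaugeConfig 3 L (Matrix.specialUnitaryGroup (Fin 2) ℂ)) (q : Edge 3 L × Fin 2 × Fin 2 × Bool) => (fun z : ℂ => if q.2.2.2 then z.im else z.re) ((fundamentalRep (Fin 2) (V q.1) : Matrix (Fin 2) (Fin 2) ℂ) q.2.1 q.2.2.1)) with hco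
  -- the carré constant for coefficient `b`
  have hlen : (((((List.range R).map (fun m : ℕ => ((Pi.single i ((m : ℕ) : ZMod L) : Site 3 L), i, false)) ++ (List.range T).map (fun m : ℕ => ((Pi.single i ((R : ℕ) : ZMod L) : Site 3 L) + (Pi.single j ((m : ℕ) : ZMod L) : Site 3 L), j, false)) ++ ((List.range R).map (fun m : ℕ => ((Pi.single j ((T : ℕ) : ZMod L) : Site 3 L) + (Pi.single i ((m : ℕ) : ZMod L) : Site 3 L), i, true))).reverse ++ ((List.range T).map (fun m : ℕ => ((Pi.single j ((m : ℕ) : ZMod L) : Site 3 L), j, true))).reverse)).length : ℕ) : ℝ) = 2 * ((R : ℝ) + T) := by rw [rectShape_length]; push_cast; ring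
  have key : ∀ b : ℝ, b ≠ 0 →
      μ.real {V | (∫ V', (fun y : (Edge 3 L × Fin 2 × Fin 2 × Bool → ℝ) => b * ∑ x ∈ B, ((((((List.range R).map (fun m : ℕ => ((Pi.single i ((m : ℕ) : ZMod L) : Site 3 L), i, false)) ++ (List.range T).map (fun m : ℕ => ((Pi.single i ((R : ℕ) : ZMod L) : Site 3 L) + (Pi.single j ((m : ℕ) : ZMod L) : Site 3 L), j, false)) ++ ((List.range R).map (fun m : ℕ => ((Pi.single j ((T : ℕ) : ZMod L) : Site 3 L) + (Pi.single i ((m : ℕ) : ZMod L) : Site 3 L), i, true))).reverse ++ ((List.range T).map (fun m : ℕ => ((Pi.single j ((m : ℕ) : ZMod L) : Site 3 L), j, true))).reverse).map (fun q : Site 3 L × Fin 3 × Bool => ((x + q.1, q.2.1), q.2.2))).map (fun a : Edge 3 L × Bool => if a.2 then ((fun (ee : Edge 3 L) => Matrix.of fun (i j : Fin 2) => ((y (ee, i, j, false) : ℝ) : ℂ) + ((y (ee, i, j, true) : ℝ) : ℂ) * Complex.I) a.1)ᴴ else (fun (ee : Edge 3 L) => Matrix.of fun (i j : Fin 2) =>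 ((y (ee, i, j, false) : ℝ) : ℂ) + ((y (ee, i, j, true) : ℝ) : ℂ) * Complex.I) a.1)).prod)).trace.re) (co V') ∂μ) + r ≤ (fun y : (Edge 3 L × Fin 2 × Fin 2 × Bool → ℝ) => b * ∑ x ∈ B, ((((((List.range R).map (fun m : ℕ => ((Pi.single i ((m : ℕ) : ZMod L) : Site 3 L), i, false)) ++ (List.range T).map (fun m : ℕ => ((Pi.single i ((R : ℕ) : ZMod L) : Site 3 L) + (Pi.single j ((m : ℕ) : ZMod L) : Site 3 L), j, false)) ++ ((List.range R).map (fun m : ℕ => ((Pi.single j ((T : ℕ) : ZMod L) : Site 3 L) + (Pi.single i ((m : ℕ) : ZMod L) : Site 3 L), i, true))).reverse ++ ((List.range T).map (fun m : ℕ => ((Pi.single j ((m : ℕ) : ZMod L) : Site 3 L), j, true))).reverse).map (fun q : Site 3 L × Fin 3 × Bool => ((x + q.1, q.2.1), q.2.2))).map (fun a : Edge 3 L × Bool => if a.2 then ((fun (ee : Edge 3 L) => Matrix.of fun (i j : Fin 2) => ((y (ee, i, j, false) : ℝ) : ℂ) + ((y (ee, i, j, true) : ℝ) : ℂ) * Complex.I)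 a.1)ᴴ else (fun (ee : Edge 3 L) => Matrix.of fun (i j : Fin 2) => ((y (ee, i, j, false) : ℝ) : ℂ) + ((y (ee, i, j, true) : ℝ) : ℂ) * Complex.I) a.1)).prod)).trace.re) (co V)} ≤
        Real.exp (-((1 - 12 * |β'|) * r ^ 2 / (32 * b ^ 2 * (((((List.range R).map (fun m : ℕ => ((Pi.single i ((m : ℕ) : ZMod L) : Site 3 L), i, false)) ++ (List.range T).map (fun m : ℕ => ((Pi.single i ((R : ℕ) : ZMod L) : Site 3 L) + (Pi.single j ((m : ℕ) : ZMod L) : Site 3 L), j, false)) ++ ((List.range R).map (fun m : ℕ => ((Pi.single j ((T : ℕ) : ZMod L) : Site 3 L) + (Pi.single i ((m : ℕ) : ZMod L) : Site 3 L), i, true))).reverse ++ ((List.range T).map (fun m : ℕ => ((Pi.single j ((m : ℕ) : ZMod L) : Site 3 L), j, true))).reverse)).length : ℕ) : ℝ) ^ 2 * (B.card : ℝ)))) := by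
    intro b hb
    have hs : 0 < 32 * b ^ 2 * (((((List.range R).map (fun m : ℕ => ((Pi.single i ((m : ℕ) : ZMod L) : Site 3 L), i, false)) ++ (List.range T).map (fun m : ℕ => ((Pi.single i ((R : ℕ) : ZMod L) : Site 3 L) + (Pi.single j ((m : ℕ) : ZMod L) : Site 3 L), j, false)) ++ ((List.range R).map (fun m : ℕ => ((Pi.single j ((T : ℕ) : ZMod L) : Site 3 L) + (Pi.single i ((m : ℕ) : ZMod L) : Site 3 L), i, true))).reverse ++ ((List.range T).map (fun m : ℕ => ((Pi.single j ((m : ℕ) : ZMod L) : Site 3 L), j, true))).reverse)).length : ℕ) : ℝ) ^ 2 * (B.card : ℝ) := by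
      have : 0 < b ^ 2 := by positivity
      rw [hlen]
      positivity
    exact wilson_concentration_uniform L β' hβ (fun y : (Edge 3 L × Fin 2 × Fin 2 × Bool → ℝ) => b * ∑ x ∈ B, ((((((List.range R).map (fun m : ℕ => ((Pi.single i ((m : ℕ) : ZMod L) : Site 3 L), i, false)) ++ (List.range T).map (fun m : ℕ => ((Pi.single i ((R : ℕ) : ZMod L) : Site 3 L) + (Pi.single j ((m : ℕ) : ZMod L) : Site 3 L), j, false)) ++ ((List.range R).map (fun m : ℕ => ((Pi.single j ((T : ℕ) : ZMod L) : Site 3 L) + (Pi.single i ((m : ℕ) : ZMod L) : Site 3 L), i, true))).reverse ++ ((List.range T).map (fun m : ℕ => ((Pi.single j ((m : ℕ) : ZMod L) : Site 3 L), j, true))).reverse).map (fun q : Site 3 L × Fin 3 × Bool => ((x + q.1, q.2.1), q.2.2))).map (fun a : Edge 3 L × Bool => if a.2 then ((fun (ee : Edge 3 L) => Matrix.of fun (i j : Fin 2) => ((y (ee, i, j, false) : ℝ) : ℂ) + ((y (ee, i, j, true) : ℝ) : ℂ) * Complex.I) a.1)ᴴ else (fun (ee : Edge 3 L) => Matrix.of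 fun (i j : Fin 2) => ((y (ee, i, j, false) : ℝ) : ℂ) + ((y (ee, i, j, true) : ℝ) : ℂ) * Complex.I) a.1)).prod)).trace.re) (contDiff_blockLoopAverage _ b B) hs (wilson_blockLoopAverage_carre_le L β' _ b B) r hr
  have hp := key (2 * (B.card : ℝ))⁻¹ (inv_ne_zero (by positivity))
  have hm := key (-(2 * (B.card : ℝ))⁻¹) (neg_ne_zero.2 (inv_ne_zero (by positivity)))
  set fp : (Edge 3 L × Fin 2 × Fin 2 × Bool → ℝ) → ℝ := (fun y : (Edge 3 L × Fin 2 × Fin 2 × Bool → ℝ) => (2 * (B.card : ℝ))⁻¹ * ∑ x ∈ B, ((((((List.range R).map (fun m : ℕ => ((Pi.single i ((m : ℕ) : ZMod L) : Site 3 L), i, false)) ++ (List.range T).map (fun m : ℕ => ((Pi.single i ((R : ℕ) : ZMod L) : Site 3 L) + (Pi.single j ((m : ℕ) : ZMod L) : Site 3 L), j, false)) ++ ((List.range R).map (fun m : ℕ => ((Pi.single j ((T : ℕ) : ZMod L) : Site 3 L) + (Pi.single i ((m : ℕ) : ZMod L) : Site 3 L), i, true))).reverse ++ ((List.range T).map (fun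 m : ℕ => ((Pi.single j ((m : ℕ) : ZMod L) : Site 3 L), j, true))).reverse).map (fun q : Site 3 L × Fin 3 × Bool => ((x + q.1, q.2.1), q.2.2))).map (fun a : Edge 3 L × Bool => if a.2 then ((fun (ee : Edge 3 L) => Matrix.of fun (i j : Fin 2) => ((y (ee, i, j, false) : ℝ) : ℂ) + ((y (ee, i, j, true) : ℝ) : ℂ) * Complex.I) a.1)ᴴ else (fun (ee : Edge 3 L) => Matrix.of fun (i j : Fin 2) => ((y (ee, i, j, false) : ℝ) : ℂ) + ((y (ee, i, j, true) : ℝ) : ℂ) * Complex.I) a.1)).prod)).trace.re) with hfpdef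
  set fm : (Edge 3 L × Fin 2 × Fin 2 × Bool → ℝ) → ℝ := (fun y : (Edge 3 L × Fin 2 × Fin 2 × Bool → ℝ) => (-(2 * (B.card : ℝ))⁻¹) * ∑ x ∈ B, ((((((List.range R).map (fun m : ℕ => ((Pi.single i ((m : ℕ) : ZMod L) : Site 3 L), i, false)) ++ (List.range T).map (fun m : ℕ => ((Pi.single i ((R : ℕ) : ZMod L) : Site 3 L) + (Pi.single j ((m : ℕ) : ZMod L) : Site 3 L), j, false)) ++ ((List.range R).map (fun m : ℕ => ((Pi.single j ((T : ℕ) : ZMod L) : Site 3 L) + (Pi.single i ((m : ℕ) : ZMod L) : Site 3 L), i, true))).reverse ++ ((List.range T).map (fun m : ℕ => ((Pi.single j ((m : ℕ) : ZMod L) : Site 3 L), j, true))).reverse).map (fun q : Site 3 L × Fin 3 × Bool => ((x + q.1, q.2.1), q.2.2))).map (fun a : Edge 3 L × Bool => if a.2 then ((fun (ee : Edge 3 L) => Matrix.of fun (i j : Fin 2) => ((y (ee, i, j, false) : ℝ) : ℂ) + ((y (ee, i, j, true) : ℝ) : ℂ) * Complex.I) a.1)ᴴ else (fun (ee : Edge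 3 L) => Matrix.of fun (i j : Fin 2) => ((y (ee, i, j, false) : ℝ) : ℂ) + ((y (ee, i, j, true) : ℝ) : ℂ) * Complex.I) a.1)).prod)).trace.re) with hfmdef
  have hvalp : ∀ V : (GaugeConfig 3 L (Matrix.specialUnitaryGroup (Fin 2) ℂ)), fp (co V) = (((B.card : ℝ))⁻¹ * ∑ x ∈ B, wilsonLoop (fundamentalRep (Fin 2)) x i j R T V) := fun V => blockLoopAverage_coords_eq V i j R T B hB
  have hfm_neg : ∀ z : (Edge 3 L × Fin 2 × Fin 2 × Bool → ℝ), fm z = -fp z := fun z => by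
    simp only [hfpdef, hfmdef]
    ring
  have hvalm : ∀ V : (GaugeConfig 3 L (Matrix.specialUnitaryGroup (Fin 2) ℂ)), fm (co V) = -(((B.card : ℝ))⁻¹ * ∑ x ∈ B, wilsonLoop (fundamentalRep (Fin 2)) x i j R T V) := fun V => by rw [hfm_neg, hvalp]
  have hmeanp : ∫ V', fp (co V') ∂μ = ∫ V', (((B.card : ℝ))⁻¹ * ∑ x ∈ B, wilsonLoop (fundamentalRep (Fin 2)) x i j R T V') ∂μ :=
    integral_congr_ae (ae_of_all _ fun V' => by beta_reduce; rw [hvalp V'])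
  have hmeanm : ∫ V', fm (co V') ∂μ = -∫ V', (((B.card : ℝ))⁻¹ * ∑ x ∈ B, wilsonLoop (fundamentalRep (Fin 2)) x i j R T V') ∂μ := by
    rw [← integral_neg]
    exact integral_congr_ae (ae_of_all _ fun V' => by beta_reduce; rw [hvalm V'])
  have hsub : {V : (GaugeConfig 3 L (Matrix.specialUnitaryGroup (Fin 2) ℂ)) | r ≤ |(((B.card : ℝ))⁻¹ * ∑ x ∈ B, wilsonLoop (fundamentalRep (Fin 2)) x i j R T V) - ∫ V', (((B.card : ℝ))⁻¹ * ∑ x ∈ B, wilsonLoop (fundamentalRep (Fin 2)) x i j R T V') ∂μ|} ⊆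
      {V | (∫ V', fp (co V') ∂μ) + r ≤ fp (co V)} ∪ {V | (∫ V', fm (co V') ∂μ) + r ≤ fm (co V)} := by
    intro V hV
    simp only [Set.mem_setOf_eq, Set.mem_union] at hV ⊢
    rw [hmeanp, hvalp, hmeanm, hvalm]
    rcases le_abs.1 hV with h | h
    · left; linarith
    · right; linarith
  have e1 : ∀ b : ℝ, b ^ 2 = ((2 * (B.card : ℝ))⁻¹) ^ 2 →
      Real.exp (-((1 - 12 * |β'|) * r ^ 2 / (32 * b ^ 2 * (((((List.range R).map (fun m : ℕ => ((Pi.single i ((m : ℕ) : ZMod L) : Site 3 L), i, false)) ++ (List.range T).map (fun m : ℕ => ((Pi.single i ((R : ℕ) : ZMod L) : Site 3 L) + (Pi.single j ((m : ℕ) : ZMod L) : Site 3 L), j, false)) ++ ((List.range R).map (fun m : ℕ => ((Pi.single j ((T : ℕ) : ZMod L) : Site 3 L) + (Pi.single i ((m : ℕ) : ZMod L) : Site 3 L), i, true))).reverse ++ ((List.range T).map (fun m : ℕ => ((Pi.single j ((m : ℕ) : ZMod L) : Site 3 L), j, true))).reverse)).length : ℕ) : ℝ) ^ 2 * (B.card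 : ℝ)))) =
      Real.exp (-((1 - 12 * |β'|) * (B.card : ℝ) * r ^ 2 / (32 * ((R : ℝ) + T) ^ 2))) := by
    intro b hb
    congr 1
    rw [hb, hlen]
    field_simp
  rw [e1 _ rfl] at hp
  rw [e1 _ (by ring)] at hm
  calc μ.real {V : (GaugeConfig 3 L (Matrix.specialUnitaryGroup (Fin 2) ℂ)) | r ≤ |(((B.card : ℝ))⁻¹ * ∑ x ∈ B, wilsonLoop (fundamentalRep (Fin 2)) x i j R T V) - ∫ V', (((B.card : ℝ))⁻¹ * ∑ x ∈ B, wilsonLoop (fundamentalRep (Fin 2)) x i j R T V') ∂μ|}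
      ≤ μ.real ({V | (∫ V', fp (co V') ∂μ) + r ≤ fp (co V)} ∪ {V | (∫ V', fm (co V') ∂μ) + r ≤ fm (co V)}) := measureReal_mono hsub
    _ ≤ μ.real {V | (∫ V', fp (co V') ∂μ) + r ≤ fp (co V)} + μ.real {V | (∫ V', fm (co V') ∂μ) + r ≤ fm (co V)} :=
        measureReal_union_le _ _
    _ ≤ Real.exp (-((1 - 12 * |β'|) * (B.card : ℝ) * r ^ 2 / (32 * ((R : ℝ) + T) ^ 2))) +
          Real.exp (-((1 - 12 * |β'|) * (B.card : ℝ) * r ^ 2 / (32 * ((R : ℝ) + T) ^ 2))) := add_le_add hp hm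
    _ = 2 * Real.exp (-((1 - 12 * |β'|) * (B.card : ℝ) * r ^ 2 / (32 * ((R : ℝ) + T) ^ 2))) := by ring

end Summit.QuantumFields.YangMills.Theorems.ColdStartUniversality
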